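import Summits.QuantumFields.YangMills.Theorems.IR.BetaSlopeFloorRungStrongCouplingTwo
import Summits.QuantumFields.YangMills.Theorems.IR.BetaSlopeFloorSliceRefl

/-!
# Line `beta-slope-floor` (crux `IR`, stmt-QuantumFields-19354): the strong-coupling rung in the LOAD's currency (reflected antipodal clauses, slice class)

Route `BalabanLadder`, crux `IR`, line `beta-slope-floor` (skeleton v5.1 `Cruxes/IR/Lines/beta_slope_floor.lean`; XL load
`stub_reflSlopeFloor` = running slope floor for the REFLECTED antipodal clauses `c_{ΘA,A}(S;S)`, `c_{A,ΘA}(S;S)` of every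
species), lead prover `ym-ir-line-bsf-p1`.  The landed rung `stub_rung_strongCoupling` (p594987) is stated for the
slice-diagonal correlator `D_b(S, A, n)`; this file restates it at the antipode `n = S` in the load's own currency on the
slice class, where `ΘA = A` (`BetaSlopeFloor.timeReflect_F_of_isSliceObs`, p588719):

* `rung_reflected_slice` — for every compact `G`, `r`, slice species `A`, `S ≥ 1`: `∃ K β_sc > 0, ∀ 0 < b ≤ β_sc`,
  `(2S/b − K)·R_b ≤ ∂_b R_b` for BOTH reflected antipodal clauses `R = c_{ΘA,A}(S;S)`, `c_{A,ΘA}(S;S)`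
  (`= latticeConnectedCorr r.ρ b (2S+1) A.timeReflect.F A.F S`, resp. `… A.F A.timeReflect.F S`).

So on the slice class the XL load's inequality `(c·a(b)·S − K_A)·R_b ≤ ∂_b R_b` holds at strong coupling with `c·a(b)`
replaced by `2/b` (pointwise in `(A, S)`): the format is exercised where everything is computable.  For non-slice species
the reflected clauses need not be non-negative in both parities, and no strong-coupling rung is claimed.

Honest framing: strong coupling only, group-blind; nothing here bears on weak coupling, `IR`, or the Yang–Mills mass gap
(Clay).  R4 of the ladder closes only the conditional finite-𝕋⁴ rung `BalabanLadder.UV`.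
-/

set_option autoImplicit false

noncomputable section

open MeasureTheory
open Literature.MathematicalPhysics.QuantumFieldTheory Literature.MathematicalPhysics.QuantumLattice

namespace Summit.QuantumFields.YangMills.Cruxes.IR.BetaSlopeFloor

variable {G : Type} [Group G] [TopologicalSpace G] [IsTopologicalGroup G] [CompactSpace G]
  [MeasurableSpace G] [BorelSpace G]

/-- **The strong-coupling rung in the load's currency (slice class).**  For a time-zero slice species both reflected
antipodal clauses coincide with the diagonal correlator at the antipode, so the landed rung gives the slope floor
`(2S/b − K)·R_b ≤ ∂_b R_b` for `0 < b ≤ β_sc`, pointwise in `(A, S)`. -/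
theorem rung_reflected_slice (r : LatticeRep G) (A : YMSpecies G) (hA : ∀ e ∈ A.supp, e.1 0 = 0 ∧ e.2 ≠ 0)
    {S : ℕ} (hS : 1 ≤ S) :
    ∃ K βsc : ℝ, 0 < βsc ∧ ∀ b : ℝ, 0 < b → b ≤ βsc →
      (2 * S / b - K) * latticeConnectedCorr r.ρ b (2 * S + 1) A.timeReflect.F A.F S ≤
          deriv (fun b' => latticeConnectedCorr r.ρ b' (2 * S + 1) A.timeReflect.F A.F S) b ∧
        (2 * S / b - K) * latticeConnectedCorr r.ρ b (2 * S + 1) A.F A.timeReflect.F S ≤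
          deriv (fun b' => latticeConnectedCorr r.ρ b' (2 * S + 1) A.F A.timeReflect.F S) b := by
  obtain ⟨K, βsc, hβsc, h⟩ := stub_rung_strongCoupling G r A hA S S hS le_rfl
  refine ⟨K, βsc, hβsc, fun b hb hbβ => ?_⟩
  have h1 := h b hb hbβ
  rw [timeReflect_F_of_isSliceObs A hA]
  exact ⟨by exact_mod_cast h1, by exact_mod_cast h1⟩

end Summit.QuantumFields.YangMills.Cruxes.IR.BetaSlopeFloor

end
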